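import Mathlib
import Summits.NavierStokesRegularity.NavierStokesRegularity.Theorems.WakeRatchetTailRatchet.Negative.TailRatchetFalseOfDyadicScalarFronts
import HarnessLib

/-!
# Scalar dyadic fronts (construction `DyadicScalarFronts`, stmt-NavierStokesRegularity-21808):
# the exact WAKE–THROUGHPUT identity `a(0⁻)² = 2(Λ/s − s/Λ)·∫_{t<0} a(t)² a(st) dt`

For a profile `a` of the scalar front equation of the inviscid dyadic chain at base `Λ = bigLam ε₀`,
`a'(t) = (Λ/s²)a(t/s)² − (s/Λ)a(t)a(st)` (`t < 0`), the shell energy `E(t) = a(t)²` of the DSS front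
`a_n(t) = (s/Λ)ⁿ a(sⁿt)` at shell `0` satisfies the exact balance `E' = (Λ²/s³)·Π(t/s) − Π(t)` with the
(normalised) energy flux `Π(t) = 2(s/Λ) a(t)² a(st)` passed to the next shell (the inflow from the shell below is
the same flux read one shell down, `(Λ²/s³)Π(t/s)`).  Integrating over the whole life `(−∞, 0)` of the shell —
for a profile that is bounded and integrable on `(−∞,0)`, enters from rest (`a → 0` at `−∞`) and has the wake
limit `a(t) → L` at `0⁻` (which exists for every admissible front, `WakeRatchetScalarFront.exists_wake_limit`) —
gives the EXACT identity (`wake_identity`)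

  `L² = 2(Λ/s − s/Λ) · ∫_{t<0} a(t)² a(st) dt`,

i.e. WAKE = `(Λ²/s² − 1)` × THROUGHPUT (total flux `∫ Π`): since the per-shell energy ratio of the front is
`μ = s²/Λ²`, the stranded energy is `(1/μ − 1)` times the energy handed on.  Consequences (`lt_bigLam_of_wake`,
`dssMu_lt_one_of_wake`): a front with positive throughput leaves a non-zero wake iff `s < Λ`, i.e. iff `μ < 1`
— the equality case `μ = 1` (zero wake, «perfect conveyor») is exactly `L = 0`.  This is the profile-level form
of the tail covariance `Θ_{n+1} = μ Θ_n` used by the tree's kill criteria, and the quantity `1 − μ` is the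
retention that the crux `TailRatchet` wanted bounded below uniformly in `ε₀` (kit: `1 − μ ≈ (5/3)ε₀ → 0`).

HONEST FRAMING: elementary real analysis (FTC with one-sided limits, change of variables) about a MODEL lattice
ODE (Tao 2016 §1.2, §4); existence of such fronts is NOT proved; nothing here concerns the Navier–Stokes
equations; no item is closed.
-/

noncomputable section

set_option linter.dupNamespace false

namespace Summit.NavierStokesRegularity.NavierStokesRegularity.Theorems

namespace WakeRatchetScalarFrontWake

open Filter Topology Set MeasureTheory intervalIntegral
open Literature.Analysis.FluidPDE Literature.Analysis.FluidPDE.TaoCascade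

variable {ε₀ s P : ℝ} {a : ℝ → ℝ}

/-- Continuity of a front profile on `t < 0`. [elementary] -/
theorem continuousOn_of_ode
    (hode : ∀ t : ℝ, t < 0 → HasDerivAt a
      (bigLam ε₀ / s ^ 2 * a (t / s) ^ 2 - s / bigLam ε₀ * a t * a (s * t)) t) :
    ContinuousOn a (Iio 0) := fun t ht => (hode t ht).continuousAt.continuousWithinAt

/-- The outgoing flux density `a(t)² a(st)` is integrable on `(−∞,0)` for a bounded integrable profile
(`|a² a(s·)| ≤ P²|a|`). [elementary] -/
theorem integrableOn_flux (hs : 0 < s) (hcont : ContinuousOn a (Iio 0))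
    (hP : ∀ t : ℝ, t < 0 → |a t| ≤ P) (hint : IntegrableOn a (Iio 0)) :
    IntegrableOn (fun t => a t ^ 2 * a (s * t)) (Iio 0) := by
  have hP0 : 0 ≤ P := by
    have := hP (-1) (by norm_num); exact (abs_nonneg _).trans this
  have hmaps : MapsTo (fun t : ℝ => s * t) (Iio 0) (Iio 0) := fun t ht => mul_neg_of_pos_of_neg hs ht
  have hc2 : ContinuousOn (fun t => a (s * t)) (Iio 0) :=
    hcont.comp (continuous_const.mul continuous_id).continuousOn hmaps
  have hqc : ContinuousOn (fun t => a t ^ 2 * a (s * t)) (Iio 0) := (hcont.pow 2).mul hc2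
  refine Integrable.mono' (g := fun t => P ^ 2 * |a t|) ((hint.abs).const_mul (P ^ 2))
    (hqc.aestronglyMeasurable measurableSet_Iio) ?_
  refine (ae_restrict_iff' measurableSet_Iio).2 (Eventually.of_forall fun t ht => ?_)
  have h1 : |a t| ≤ P := hP t ht
  have h2 : |a (s * t)| ≤ P := hP _ (hmaps ht)
  rw [Real.norm_eq_abs, abs_mul, abs_pow]
  calc |a t| ^ 2 * |a (s * t)| ≤ (|a t| * P) * P := by
        rw [sq, mul_assoc, mul_assoc]
        exact mul_le_mul_of_nonneg_left (mul_le_mul h1 h2 (abs_nonneg _) hP0) (abs_nonneg _)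
    _ = P ^ 2 * |a t| := by ring

/-- The incoming flux density `a(t/s)² a(t)` is integrable on `(−∞,0)` likewise. [elementary] -/
theorem integrableOn_feed (hs : 0 < s) (hcont : ContinuousOn a (Iio 0))
    (hP : ∀ t : ℝ, t < 0 → |a t| ≤ P) (hint : IntegrableOn a (Iio 0)) :
    IntegrableOn (fun t => a (t / s) ^ 2 * a t) (Iio 0) := by
  have hP0 : 0 ≤ P := by
    have := hP (-1) (by norm_num); exact (abs_nonneg _).trans this
  have hmaps : MapsTo (fun t : ℝ => t / s) (Iio 0) (Iio 0) := fun t ht => div_neg_of_neg_of_pos ht hs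
  have hc2 : ContinuousOn (fun t => a (t / s)) (Iio 0) :=
    hcont.comp (continuous_id.div_const s).continuousOn hmaps
  have hpc : ContinuousOn (fun t => a (t / s) ^ 2 * a t) (Iio 0) := (hc2.pow 2).mul hcont
  refine Integrable.mono' (g := fun t => P ^ 2 * |a t|) ((hint.abs).const_mul (P ^ 2))
    (hpc.aestronglyMeasurable measurableSet_Iio) ?_
  refine (ae_restrict_iff' measurableSet_Iio).2 (Eventually.of_forall fun t ht => ?_)
  have h2 : |a (t / s)| ≤ P := hP _ (hmaps ht)
  rw [Real.norm_eq_abs, abs_mul, abs_pow]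
  have h3 : |a (t / s)| ^ 2 ≤ P ^ 2 := pow_le_pow_left₀ (abs_nonneg _) h2 2
  exact mul_le_mul_of_nonneg_right h3 (abs_nonneg _)

/-- Interval integrability on `[A, 0]` from integrability on `(−∞, 0)`. [elementary] -/
theorem intervalIntegrable_of_Iio {f : ℝ → ℝ} (hf : IntegrableOn f (Iio 0)) {A : ℝ} (hA : A ≤ 0) :
    IntervalIntegrable f volume A 0 := by
  rw [intervalIntegrable_iff_integrableOn_Ioc_of_le hA]
  exact ((integrableOn_Iic_iff_integrableOn_Iio (by finiteness)).2 hf).mono_set Ioc_subset_Iic_self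

/-- **The wake–throughput identity.**  For a bounded, integrable profile of the scalar front equation on
`t < 0` that enters from rest (`a → 0` at `−∞`) and has the wake limit `a → L` at `0⁻`:
`L² = 2(Λ/s − s/Λ) ∫_{t<0} a(t)² a(st) dt`.
[cite: Tao2016AveragedNS, §1.2 (dyadic model, energy transfer `λⁿ X_{n+1}X_n²`); elementary] -/
theorem wake_identity (hε : 0 < ε₀) (hs : 1 < s)
    (hode : ∀ t : ℝ, t < 0 → HasDerivAt a
      (bigLam ε₀ / s ^ 2 * a (t / s) ^ 2 - s / bigLam ε₀ * a t * a (s * t)) t)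
    (hP : ∀ t : ℝ, t < 0 → |a t| ≤ P) (hint : IntegrableOn a (Iio 0))
    (hbot : Tendsto a atBot (𝓝 0)) {L : ℝ} (hL : Tendsto a (𝓝[<] 0) (𝓝 L)) :
    L ^ 2 = 2 * (bigLam ε₀ / s - s / bigLam ε₀) * ∫ t in Iio 0, a t ^ 2 * a (s * t) := by
  have hΛ : 0 < bigLam ε₀ := bigLam_pos (by linarith)
  have hs0 : 0 < s := by linarith
  have hcont := continuousOn_of_ode hode
  have hq := integrableOn_flux hs0 hcont hP hint
  have hp := integrableOn_feed hs0 hcont hP hint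
  -- the energy and its derivative
  have hE : ∀ t ∈ Iio (0 : ℝ), HasDerivAt (fun t => a t ^ 2)
      (2 * (bigLam ε₀ / s ^ 2) * (a (t / s) ^ 2 * a t) - 2 * (s / bigLam ε₀) * (a t ^ 2 * a (s * t))) t := by
    intro t ht
    have h := (hode t ht).pow 2
    refine h.congr_deriv ?_
    push_cast
    ring
  have he : IntegrableOn (fun t => 2 * (bigLam ε₀ / s ^ 2) * (a (t / s) ^ 2 * a t)
      - 2 * (s / bigLam ε₀) * (a t ^ 2 * a (s * t))) (Iio 0) :=
    (hp.const_mul _).sub (hq.const_mul _)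
  -- step 1: the balance over `(A, 0)` with one-sided limits at both ends
  have hbal : ∀ A : ℝ, A < 0 →
      L ^ 2 - a A ^ 2 = 2 * (bigLam ε₀ / s ^ 2) * (s * ∫ t in (A / s)..0, a t ^ 2 * a (s * t))
        - 2 * (s / bigLam ε₀) * ∫ t in A..0, a t ^ 2 * a (s * t) := by
    intro A hA
    have hftc := intervalIntegral.integral_eq_sub_of_hasDerivAt_of_tendsto hA
      (fun t ht => hE t ht.2) (intervalIntegrable_of_Iio he hA.le)
      ((hE A hA).continuousAt.continuousWithinAt.tendsto) (hL.pow 2)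
    rw [← hftc, intervalIntegral.integral_sub ((intervalIntegrable_of_Iio hp hA.le).const_mul _)
      ((intervalIntegrable_of_Iio hq hA.le).const_mul _), intervalIntegral.integral_const_mul,
      intervalIntegral.integral_const_mul]
    congr 2
    -- the feed integral is the flux integral one shell down: substitute `t = s u`
    have hfun : (fun t => a (t / s) ^ 2 * a t) = fun t => a (t / s) ^ 2 * a (s * (t / s)) := by
      funext t; rw [mul_div_cancel₀ t hs0.ne']
    rw [hfun, intervalIntegral.integral_comp_div (fun t => a t ^ 2 * a (s * t)) hs0.ne', zero_div,
      smul_eq_mul]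
  -- step 2: let `A → −∞`
  have hqIic : IntegrableOn (fun t => a t ^ 2 * a (s * t)) (Iic 0) :=
    (integrableOn_Iic_iff_integrableOn_Iio (by finiteness)).2 hq
  have hlim1 : Tendsto (fun A : ℝ => ∫ t in A..0, a t ^ 2 * a (s * t)) atBot
      (𝓝 (∫ t in Iic 0, a t ^ 2 * a (s * t))) :=
    intervalIntegral_tendsto_integral_Iic 0 hqIic tendsto_id
  have hlim2 : Tendsto (fun A : ℝ => ∫ t in (A / s)..0, a t ^ 2 * a (s * t)) atBot
      (𝓝 (∫ t in Iic 0, a t ^ 2 * a (s * t))) :=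
    intervalIntegral_tendsto_integral_Iic 0 hqIic (tendsto_id.atBot_div_const hs0)
  have hR : Tendsto (fun A : ℝ => 2 * (bigLam ε₀ / s ^ 2) * (s * ∫ t in (A / s)..0, a t ^ 2 * a (s * t))
      - 2 * (s / bigLam ε₀) * ∫ t in A..0, a t ^ 2 * a (s * t)) atBot
      (𝓝 (2 * (bigLam ε₀ / s ^ 2) * (s * ∫ t in Iic 0, a t ^ 2 * a (s * t))
        - 2 * (s / bigLam ε₀) * ∫ t in Iic 0, a t ^ 2 * a (s * t))) :=
    ((hlim2.const_mul s).const_mul _).sub (hlim1.const_mul _)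
  have hLft : Tendsto (fun A : ℝ => L ^ 2 - a A ^ 2) atBot (𝓝 (L ^ 2 - 0 ^ 2)) :=
    tendsto_const_nhds.sub (hbot.pow 2)
  have heq : (fun A : ℝ => L ^ 2 - a A ^ 2) =ᶠ[atBot]
      (fun A : ℝ => 2 * (bigLam ε₀ / s ^ 2) * (s * ∫ t in (A / s)..0, a t ^ 2 * a (s * t))
        - 2 * (s / bigLam ε₀) * ∫ t in A..0, a t ^ 2 * a (s * t)) := by
    filter_upwards [eventually_lt_atBot (0 : ℝ)] with A hA using hbal A hA
  have hfin := tendsto_nhds_unique_of_eventuallyEq hLft hR heq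
  rw [integral_Iic_eq_integral_Iio] at hfin
  have e1 : L ^ 2 - 0 ^ 2 = L ^ 2 := by ring
  rw [e1] at hfin
  rw [hfin]
  field_simp

/-- **A non-zero wake forces `s < Λ`** (for positive throughput `∫ a² a(s·) > 0`, e.g. a positive front):
the per-shell energy ratio `μ = s²/Λ²` of a front that strands energy is `< 1`.
[cite: Tao2016AveragedNS, §1.2; elementary] -/
theorem lt_bigLam_of_wake (hε : 0 < ε₀) (hs : 1 < s)
    (hode : ∀ t : ℝ, t < 0 → HasDerivAt a
      (bigLam ε₀ / s ^ 2 * a (t / s) ^ 2 - s / bigLam ε₀ * a t * a (s * t)) t)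
    (hP : ∀ t : ℝ, t < 0 → |a t| ≤ P) (hint : IntegrableOn a (Iio 0))
    (hbot : Tendsto a atBot (𝓝 0)) {L : ℝ} (hL : Tendsto a (𝓝[<] 0) (𝓝 L)) (hLne : L ≠ 0)
    (hQ : 0 < ∫ t in Iio 0, a t ^ 2 * a (s * t)) : s < bigLam ε₀ := by
  have hΛ : 0 < bigLam ε₀ := bigLam_pos (by linarith)
  have hs0 : 0 < s := by linarith
  have h := wake_identity hε hs hode hP hint hbot hL
  have hL2 : 0 < L ^ 2 := by positivity
  have hcoef : 0 < bigLam ε₀ / s - s / bigLam ε₀ := by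
    rcases lt_or_ge 0 (bigLam ε₀ / s - s / bigLam ε₀) with hpos | hle
    · exact hpos
    · have : 2 * (bigLam ε₀ / s - s / bigLam ε₀) * ∫ t in Iio 0, a t ^ 2 * a (s * t) ≤ 0 :=
        mul_nonpos_of_nonpos_of_nonneg (by linarith) hQ.le
      linarith
  have h2 : s / bigLam ε₀ < bigLam ε₀ / s := by linarith
  rw [div_lt_div_iff₀ hΛ hs0] at h2
  nlinarith

/-- **Equivalently, `dssMu < 1`**: the DSS wave carried by such a front (`isDSSWave_dyadic_of_scalarFront`,
delay `T = log s`) has per-shell energy ratio `dssMu ε₀ (log s) = s²/(1+ε₀)⁵ < 1`.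
[cite: Tao2016AveragedNS, §1.2, §4 (4.1); elementary] -/
theorem dssMu_lt_one_of_wake (hε : 0 < ε₀) (hs : 1 < s)
    (hode : ∀ t : ℝ, t < 0 → HasDerivAt a
      (bigLam ε₀ / s ^ 2 * a (t / s) ^ 2 - s / bigLam ε₀ * a t * a (s * t)) t)
    (hP : ∀ t : ℝ, t < 0 → |a t| ≤ P) (hint : IntegrableOn a (Iio 0))
    (hbot : Tendsto a atBot (𝓝 0)) {L : ℝ} (hL : Tendsto a (𝓝[<] 0) (𝓝 L)) (hLne : L ≠ 0)
    (hQ : 0 < ∫ t in Iio 0, a t ^ 2 * a (s * t)) : dssMu ε₀ (Real.log s) < 1 := by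
  have hs0 : 0 < s := by linarith
  have hb : 0 < 1 + ε₀ := by linarith
  have hlt := lt_bigLam_of_wake hε hs hode hP hint hbot hL hLne hQ
  unfold dssMu
  rw [show 2 * Real.log s = Real.log (s ^ 2) by rw [Real.log_pow]; norm_num, Real.exp_log (by positivity),
    div_lt_one (by positivity), ← bigLam_sq hε.le]
  exact pow_lt_pow_left₀ hlt hs0.le two_ne_zero

end WakeRatchetScalarFrontWake

end Summit.NavierStokesRegularity.NavierStokesRegularity.Theorems

end
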